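import Summits.BirchSwinnertonDyer.BirchSwinnertonDyer.Theorems.ByReductionTypeAtTwoSupersingularFlatCountTwoOfH1Sigma
import Summits.BirchSwinnertonDyer.BirchSwinnertonDyer.Theorems.ByReductionTypeAtTwoSupersingularFlatLocalLiftAway
import Literature.NumberTheory.EllipticCurves.Greenberg1999.LocalQuotientControlSurjective
import HarnessLib

/-!
# COUNT♭@2 FROM PRINT BY NAME, LOC AWAY FROM 2 DISCHARGED TO PRINT: the door of part 12 with the local lifts at
# the finite `w ∤ 2` of `Σ₀` replaced by Greenberg's p. 108 surjectivity `𝒫_E^{(v)}(F) ↠ 𝒫_E^{(v)}(F_∞)^Γ`, cited by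
# name — the displayed residue is now AT 2 ONLY: (b₁) weak Leopoldt for `E[2^∞]` over `ℚ_∞`, (LOC♭) the `♭`-local lift

Seat `bsd-2adic-ss-1` GEN 12, crux `SupersingularRankZeroAtTwo` (item stmt-BirchSwinnertonDyer-19097, route
`ByReductionTypeAtTwo`, rung K4), line `flat_uniform_two` v1, stub (2) `stub_allFlatData`, conjunct COUNT♭@2 —
part 14. Composition of part 12 (`flatCountTwo_of_print_of_h1SigmaCorank`), part 13
(`exists_localLift_of_localSurj`: «LOC at `w`» ⟸ the local surjectivity, for any `Sel ≤ 𝒦_w`; here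
`Sel = Sel♭_∞ ≤ Sel_∞ ≤ 𝒦_w`) and the named fact `Greenberg1999.localQuotient_restriction_surjective ℚ` (LNM 1716
p. 108: «showing that `𝒫_E^{(v)}(F) → 𝒫_E^{(v)}(F_∞)^Γ` is surjective … the maps `r_v` for `v ∤ p`»).
HONEST TAG of COUNT♭@2 after this file: PRINT-by-name {Prop. 4.13 = Cassels, Prop. 4.12, pp. 119–120 corank
count, p. 108 local surjectivity} ∘ THEOREM (parts 1–13) ∘ displayed {(b₁) a finitely generated dual datum `Y` of
`H¹(ℚ_Σ/ℚ_∞, E[2^∞])` with `rank_Λ Y = 1` [PRINT: Kato Astérisque 295 Thm. 12.4 read through Prop. 4.12 sentence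
1], (LOC♭) the single-place `♭`-local lift `hloc2` at the place above `2` [kernel-able: `(L♭)_Γ = 0`, `cd = 1`]}.
Nothing about any curve is asserted; no census cell moves; BSD is not proved by any of this.

References: [GreenbergLNM1716] §4 Prop. 4.12, Prop. 4.13 / p. 122, pp. 108, 119–120; [Kato2004Asterisque] Thm. 12.4.
-/

set_option autoImplicit false
-- the Theorems namespace of this sub repeats the summit name by design (D-0017 nested layout)
set_option linter.dupNamespace false

noncomputable section

open scoped Classical NumberField

open NumberField IsDedekindDomain

namespace Summit.BirchSwinnertonDyer.BirchSwinnertonDyer.Theorems.SSFlatEC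

open Literature.NumberTheory.EllipticCurves Literature.NumberTheory.GaloisRepresentations
  WeierstrassCurve ZpExtension Literature.NumberTheory.EllipticCurves.Kobayashi2003
  Literature.NumberTheory.EllipticCurves.Sprung2017 Literature.NumberTheory.EllipticCurves.Sprung2012
  Literature.NumberTheory.EllipticCurves.Sprung2024 Literature.NumberTheory.EllipticCurves.IwasawaDual
  Literature.NumberTheory.EllipticCurves.IwasawaAlgebra Literature.NumberTheory.EllipticCurves.GreenbergVatsal2000
  Literature.NumberTheory.EllipticCurves.Rank1Residual Summit.BirchSwinnertonDyer.Rank1Residual.X5.O1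

/-- **THE DOOR with (b₂) and LOC-away-from-2 discharged to print.** As `flatCountTwo_of_print_of_h1SigmaCorank`
(part 12), with the local-lift hypothesis `hloc` at the finite `w ∈ Σ₀ ∪ {2}` replaced by: PRINT BY NAME
`Greenberg1999.localQuotient_restriction_surjective ℚ` (p. 108, the places `w ∤ 2`) and the displayed `♭`-local lift
`hloc2` at the place(s) `w ∋ 2` only. For `w ∤ 2`: `Sel♭_∞ ≤ Sel_∞ ≤ 𝒦_w` (`sharpFlatSelmerInfty_le_selmerInfty`,
definition of `Sel_∞`), so part 13 (`exists_localLift_of_localSurj`) applies, and the `♭`-clause is vacuous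
(`w = v` would put `2 ∈ w`). [cite: GreenbergLNM1716, §4 pp. 108, 119–120, Prop. 4.12, Prop. 4.13 / p. 122] -/
theorem flatCountTwo_of_print_of_localSurj (W : WeierstrassCurve ℚ) [W.IsElliptic] [W.IsGloballyMinimal]
    (hss : GoodSS W 2) (κ : ZpExtension ℚ 2) (hκ : κ.IsCyclotomic) {γ : Field.absoluteGaloisGroup ℚ}
    (hγ : κ.IsTopGenerator γ) {v : HeightOneSpectrum (𝓞 ℚ)} (hv : (2 : 𝓞 ℚ) ∈ v.asIdeal)
    {g : Field.absoluteGaloisGroup (v.adicCompletion ℚ)} {c : ℕ → localPoints W (v.adicCompletion ℚ)}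
    (hg : κ.IsTopGenerator (resGalOfEmb (closureEmb (K := ℚ) (v.adicCompletion ℚ)) g))
    (hc : ∀ n, c n ∈ localLayerPointsOfEmb κ (closureEmb (K := ℚ) (v.adicCompletion ℚ)) W n)
    (hTr : ∀ n, 1 ≤ n → localTraceOfEmb κ (closureEmb (K := ℚ) (v.adicCompletion ℚ)) W n (n + 1)
      (c (n + 1)) = W.frobeniusTrace 2 • c n - c (n - 1))
    (hinj : ∀ z₀ : localLayerPointsOfEmb κ (closureEmb (K := ℚ) (v.adicCompletion ℚ)) W 0 →+ ℤ_[2],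
      evalOn W (localLayerPointsOfEmb κ (closureEmb (K := ℚ) (v.adicCompletion ℚ)) W 0) z₀ (c 0) = 0 →
        z₀ = 0)
    (hsat : ∀ a : ℤ_[2],
      (∃ z₀ : localLayerPointsOfEmb κ (closureEmb (K := ℚ) (v.adicCompletion ℚ)) W 0 →+ ℤ_[2],
        evalOn W (localLayerPointsOfEmb κ (closureEmb (K := ℚ) (v.adicCompletion ℚ)) W 0) z₀ (c 0) =
          2 * a) →
      ∃ y : localLayerPointsOfEmb κ (closureEmb (K := ℚ) (v.adicCompletion ℚ)) W 0 →+ ℤ_[2],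
        evalOn W (localLayerPointsOfEmb κ (closureEmb (K := ℚ) (v.adicCompletion ℚ)) W 0) y (c 0) = a)
    (S₀ : Finset (HeightOneSpectrum (𝓞 ℚ)))
    (hgood : ∀ w : HeightOneSpectrum (𝓞 ℚ), w ∉ S₀ → ((2 : ℕ) : 𝓞 ℚ) ∉ w.asIdeal → W.HasGoodReductionAt w)
    -- PRINT BY NAME
    (hC : Greenberg1999.casselsSurjectivity_H1Sigma ℚ)
    (h412 : Greenberg1999.prop412_noFiniteSubmodule_H1Sigma_of_rank_one)
    (hcork : Greenberg1999.h1Sigma_zpCorank_le_degree ℚ)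
    (hP108 : Greenberg1999.localQuotient_restriction_surjective ℚ)
    -- (b₁): a finitely generated dual datum of `H¹(ℚ_Σ/ℚ_∞, E[2^∞])` of `Λ`-rank `1`
    {Y : Type} [AddCommGroup Y] [Module (IwasawaAlgebra 2) Y] [Module.Finite (IwasawaAlgebra 2) Y]
    (dY : Y →+ (unramifiedOutside κ.kerSubgroup (W.geomPrimaryTorsion 2) 2
      (↑S₀ : Set (HeightOneSpectrum (𝓞 ℚ))) →+ AddCircle (1 : ℚ)))
    (hbij : Function.Bijective dY)
    (hT : ∀ (y : Y) (x : unramifiedOutside κ.kerSubgroup (W.geomPrimaryTorsion 2) 2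
        (↑S₀ : Set (HeightOneSpectrum (𝓞 ℚ)))),
      dY ((PowerSeries.X : IwasawaAlgebra 2) • y) x =
        dY y ⟨W.conjH1 2 κ.kerSubgroup γ x,
          conjH1_mem_unramifiedOutside κ.kerSubgroup (W.geomPrimaryTorsion 2) 2 _ γ x.2⟩ - dY y x)
    (hCY : ∀ (a : ℤ_[2]) (y : Y) (x : unramifiedOutside κ.kerSubgroup (W.geomPrimaryTorsion 2) 2
        (↑S₀ : Set (HeightOneSpectrum (𝓞 ℚ)))) (k : ℕ), (2 ^ k) • x = 0 →
      dY (PowerSeries.C a • y) x = (PadicInt.toZModPow k a).val • dY y x)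
    (hrank : Module.rank (IwasawaAlgebra 2) Y = 1)
    -- (LOC♭): the single-place local lift at the place(s) above `2`, with the `♭`-clause
    (hloc2 : ∀ t ∈ unramifiedOutside κ.kerSubgroup (W.geomPrimaryTorsion 2) 2
        (↑S₀ : Set (HeightOneSpectrum (𝓞 ℚ))),
      (∀ σ : Field.absoluteGaloisGroup ℚ, W.conjH1 2 κ.kerSubgroup σ t - t ∈
        sharpFlatSelmerInfty W κ (closureEmb (K := ℚ) (v.adicCompletion ℚ)) (W.frobeniusTrace 2) g c .flat) →
      ∀ w : HeightOneSpectrum (𝓞 ℚ), ((2 : ℕ) : 𝓞 ℚ) ∈ w.asIdeal →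
      ∃ xw : discreteH1 (localSubgroup (⊤ : Subgroup (Field.absoluteGaloisGroup ℚ)) (w.adicCompletion ℚ))
          (localPoints W (w.adicCompletion ℚ)),
        (∃ k : ℕ, 2 ^ k • xw = 0) ∧
        ∀ y : W.subgroupH1 2 (⊤ : Subgroup (Field.absoluteGaloisGroup ℚ)),
          W.localResOver 2 ⊤ (w.adicCompletion ℚ) y = xw →
          t - W.resOfLe 2 (le_top : κ.kerSubgroup ≤ ⊤) y ∈
              W.localKerOver 2 κ.kerSubgroup (w.adicCompletion ℚ) ∧
          (w = v → t - W.resOfLe 2 (le_top : κ.kerSubgroup ≤ ⊤) y ∈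
            sharpFlatLocalKummerOverOfEmb W 2 κ.kerSubgroup (closureEmb (K := ℚ) (v.adicCompletion ℚ))
              (localTowerPointsOfEmb κ (closureEmb (K := ℚ) (v.adicCompletion ℚ)) W)
              (colemanKer κ (closureEmb (K := ℚ) (v.adicCompletion ℚ)) W (W.frobeniusTrace 2) g c .flat))) :
    Finite (W.selmerGroupPInfty 2) →
      Finite (EndCoinvariants (conjSharpFlatSelmerInfty W κ (closureEmb (K := ℚ) (v.adicCompletion ℚ))
        (W.frobeniusTrace 2) g c .flat γ - 1)) →
      Nat.card (↥((sharpFlatSelmerInfty W κ (closureEmb (K := ℚ) (v.adicCompletion ℚ))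
            (W.frobeniusTrace 2) g c .flat).comap (W.layerToInfty κ 0)) ⧸
          (W.selmerLayer κ 0).addSubgroupOf
            ((sharpFlatSelmerInfty W κ (closureEmb (K := ℚ) (v.adicCompletion ℚ))
              (W.frobeniusTrace 2) g c .flat).comap (W.layerToInfty κ 0))) *
        Nat.card (MulAction.fixedPoints (Field.absoluteGaloisGroup ℚ) (W.geomPrimaryTorsion 2)) =
      2 ^ (padicValNat 2 W.tamagawaProduct) *
        Nat.card (EndCoinvariants (conjSharpFlatSelmerInfty W κ
          (closureEmb (K := ℚ) (v.adicCompletion ℚ)) (W.frobeniusTrace 2) g c .flat γ - 1)) := by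
  -- `Sel♭_∞ ≤ Sel_∞ ≤ 𝒦_w` at every finite `w`
  have hSelle : ∀ w : HeightOneSpectrum (𝓞 ℚ),
      sharpFlatSelmerInfty W κ (closureEmb (K := ℚ) (v.adicCompletion ℚ)) (W.frobeniusTrace 2) g c .flat ≤
        W.localKerOver 2 κ.kerSubgroup (w.adicCompletion ℚ) := fun w s hs ↦ by
    have h1 := ((W.mem_selmerGroupOver_iff 2 κ.kerSubgroup s).1
      (sharpFlatSelmerInfty_le_selmerInfty W κ _ _ g c .flat hs)).1 w 1
    have hone : W.conjH1 2 κ.kerSubgroup 1 = AddMonoidHom.id _ :=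
      conjH1_of_mem_holds κ.kerSubgroup _ (one_mem _)
    rwa [hone, AddMonoidHom.id_apply] at h1
  refine flatCountTwo_of_print_of_h1SigmaCorank W hss κ hκ hγ hv hg hc hTr hinj hsat S₀ hgood hC h412 hcork dY
    hbij hT hCY hrank (fun t ht hconj w _ ↦ ?_)
  by_cases h2 : ((2 : ℕ) : 𝓞 ℚ) ∈ w.asIdeal
  · exact hloc2 t ht hconj w h2
  · -- `w ∤ 2`: Greenberg p. 108 by name, through part 13; the `♭`-clause is vacuous
    obtain ⟨xw, hx, hmain⟩ := exists_localLift_of_localSurj W κ (hP108 W 2 κ hκ w h2) _ (hSelle w) t hconj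
    refine ⟨xw, hx, fun y hy ↦ ⟨hmain y hy, fun hwv ↦ absurd ?_ h2⟩⟩
    rw [hwv]
    exact_mod_cast hv

end Summit.BirchSwinnertonDyer.BirchSwinnertonDyer.Theorems.SSFlatEC

end
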